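import Literature.MathematicalPhysics.QuantumFieldTheory.Balaban1983to89.B8Ineq159FlatDentedCubeMemberPrintedRec

/-!
# `Balaban1983to89.B8Ineq159FlatCovPrintedRec` — [Balaban1985RegularSpaces] (1.59) p. 86 ∕ (1.62) p. 87 AT `U₀ = 1` (= [Balaban1985BackgroundPropagators] Thm 3.3) FOR THE
# RECORD's LINEARISED AVERAGING `Q_j(1)` OF [Balaban1987RG1] (0.4), on the centred cube member `{□_j}` of (1.131) and on the dented member `{Ω′_j}` of
# [Balaban1985Variational] (148)–(150): the two named facts `Ineq159FlatCubeMemberCovPrintedZ d L`, `Ineq159FlatDentedCubeMemberCovPrintedZ d L`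

statement-level skeleton of published theorems with citation tags; proofs where landed; nothing here is a claim about the Yang–Mills mass gap

T. Bałaban, *Spaces of regular gauge field configurations on a lattice and gauge fixing conditions*, Commun. Math. Phys. **99** (1985) 75–102 `[Balaban1985RegularSpaces]`
("[6]"): (1.55)–(1.59) p. 86, (1.62) p. 87, (1.31) p. 82, (1.38) p. 82, (1.131)–(1.132) p. 99, p. 98; T. Bałaban, *Propagators for lattice gauge theories in a background field*,
Commun. Math. Phys. **99** (1985) 389–434 `[Balaban1985BackgroundPropagators]` ("[4]"): (3.13) p. 392, (3.14)–(3.16) p. 393, Thm 3.3 p. 399, (3.47) p. 398; T. Bałaban, *Averaging operations for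
lattice gauge theories*, Commun. Math. Phys. **98** (1985) 17–51 `[Balaban1985Averaging]` ("[3]"): (89)–(92) p. 31, (124) p. 36, Prop. 4 p. 37; T. Bałaban, *The variational problem
and background fields in renormalization group method for lattice gauge theories*, Commun. Math. Phys. **102** (1985) 277–309 `[Balaban1985Variational]` ("[15]"): (148)–(152)
p. 301; T. Bałaban, *Renormalization group approach to lattice gauge field theories. I*, Commun. Math. Phys. **109** (1987) 249–301 `[Balaban1987RG1]` ("[I]"): (0.3)–(0.4)
pp. 252–253.  STATUS: published, refereed.

CITATION HEADER (lean-in-tree rule).  Cell `pub-ymgap`, «N05-REC» stage 2 (director-ym №254∕№255∕№288), item R6 (f)-0 — typed by the LEAD PEN dag-n05-e g39 (bus FINDING-1,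
2026-08-29; quotes confirmed on the OCR by the lit-balaban desk, bus I.29198 ∕ I.29202).  WHICH OPERATOR (1.59) IS ABOUT, AS PRINTED: [4] p. 392 «Let us remark only that the
averaging operation used here is the operation Ūʲ defined by the formulas (89)–(92) of that paper [= [3]]. We replace U₀ by U in these definitions» and p. 393 «(3.14) where
Q_j(U)A is a linear part of the function (3.13) … We are interested in the linear operators Q_j(U). They are compositions of j one-step averaging operators Q(Ū^{j−1}) … Q(Ū)Q(U) (3.15) where Q(V) is given by
the explicit formula (124) in [3]»; [6] p. 86 «Proposition 4 from [3] implies that Q̄_j(U₀, ηA) = LʲηQ_jA + C_j(LʲηA), |C_j(LʲηA)| ≦ C₂|LʲηA|² < C₂α₂², (1.56) hence LʲηQ_jA = B₁ …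
Theorem 3.3 of [4] implies the bounds (1.59)».  So print's
`Q_j(U₀)` in (1.55)–(1.62) is the LINEARISATION of [3]'s averaging — for the record programme (centred symmetrised averaging (0.4) of [I]) this is dag-n05-e's
`B7SectEFLinearisationRec.linCovIterZ L U₀`, whose flat value is NOT the straight centred iterate: `linCovIterZ L 1 B j = linQIterZ L B j + d(Θ_j B)` with the carried letter
`Θ_j ≠ 0` (`B7Prop4FlatCarriedLetterRec.linCovIterZ_one_eq`).  WHAT IS TYPED = the two named facts of dag-n05-e g38's `B8Ineq159FlatCubeMemberPrintedRec.Ineq159FlatCubeMemberPrintedZ`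
(p717853) ∕ `B8Ineq159FlatDentedCubeMemberPrintedRec.Ineq159FlatDentedCubeMemberPrintedZ` (p720763) BYTE-IDENTICAL EXCEPT FOR ONE TOKEN: the averaging datum (ii) reads
`‖linCovIterZ L 1 (iηφ) j c‖ ≤ N` (the record's linearised `j`-fold average (3.15), flat background) instead of the STRAIGHT `‖linQIterZ L (iηφ) j c‖ ≤ N`.  The straight twins
are PROVED (translations of the engine's facts for the simple averaging (0.3), whose flat linearisation IS straight); the present ones are [4] Thm 3.3 ∕ [6] (1.59), (1.62) AS
PRINTED for the record's averaging and are NAMED HERE, NOT PROVED: their proof is [4] §3's Green's-function analysis for the constraint operators «straight block average +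
coarse gradient of the carried letter», which the tree's torus library (straight block averages) does not cover.  DEDUP-TO-PRINT (director-ym №293 (1)(b), answered NO by lit-balaban-r06 g72 ∕ lead g37 ∕ this pen, bus
I.29215 ∕ I.29217): each fact = [Balaban1985BackgroundPropagators] Thm 3.3 p. 399 ((3.42) p. 397, (3.47) p. 398 at γ = −3) at the flat background U = 1 for G = (Δ_a↾□₀)⁻¹, Δ_a of
(3.26)–(3.27) p. 395 with the averaging Q_j(1) of (3.14)–(3.15) p. 393 (the linearisation of [Balaban1985Averaging] (89)–(92), p. 392) = `linCovIterZ L 1`, composed with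
[Balaban1985RegularSpaces] (1.55)–(1.58) p. 86; the tree's `B9.Thm33Printed` types Thm 3.3 over ABSTRACT carriers (`B9.KernelFamily`, «this file never identifies them») and is not
instantiated at this operator (no Lean object for the Dirichlet inverse G(U) on `□₀` built on `linCovIterZ L U`; no `{Ω_j}`-chain slot for the dent), and the torus library
([Balaban1984PropagatorsII] Prop. 2.6, `TorusGreenDecay`) is the straight-average case — hence NAMED here, unproved; proof owed (director-ym №293 (1)(d): new analysis, [4] Sect. C
pp. 408–416, Thm 3.7 → 3.9–3.11 → 3.1–3.3; abelian torus-native template Dimock arXiv:1502.02946 §3).  They are the two displayed premises of the record crown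
`B8Prop6DentedCubeMemberScalarGammaHoldsRec` (R6 (g)); the datum (ii) is exactly the `wsup` member shape of the crown's H59 binder (dag-n05-e g38's
`B8Prop6DentedCubeMemberGammaRec.prop6_exists_dentedMember_at_γ₃`, `B8Ineq159FlatOfScalarBdryBetaRec`) and of [6] (1.56)'s `B₁` for the record (`B8Eq156KLevelLocalRec.norm_B1_lt_kLevel`).
Kind «definition» (two `def … : Prop`, no theorem, no `instance`, no `notation`); no existing module modified.  `--supports stmt-QuantumFields-20541` (K0⁷-keyed, COUNT-NEUTRAL).

HONEST SCOPE: two NAMED, UNPROVED published statements (typed for the record's operators); nothing of [3]∕[4]∕[6]∕[15]∕[I] proved here; no relation to the straight twins is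
claimed beyond `linCovIterZ_one_eq`; `HThm4Rec` UNDISCHARGED; N05 ∕ N07 NOT discharged; COUNT of record unmoved · K numerically unchanged; one finite `𝕋⁴` programme at fixed `ε`,
Bałaban AS PRINTED; nothing continuum ∕ ℝ⁴ ∕ OS ∕ mass-gap ∕ Clay.  No `sorry`.

[cite: Balaban1985RegularSpaces, (1.59) p.86, (1.62) p.87, (1.55)–(1.56) p.86, (1.31) p.82, (1.38) p.82, (1.131)–(1.132) p.99, p.98; Balaban1985BackgroundPropagators,
(3.13) p.392, (3.14)–(3.16) p.393, Theorem 3.3 p.399, (3.47) p.398; Balaban1985Averaging, (89)–(92) p.31, (124) p.36, Prop. 4 p.37; Balaban1985Variational, (148)–(152) p.301, p.300;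
Balaban1987RG1, (0.3)–(0.4) pp.252–253]
-/

noncomputable section

open Classical

namespace Literature.MathematicalPhysics.QuantumFieldTheory.Balaban1983to89.B8Ineq159FlatCovPrintedRec

open BlockAveragingZd (ctrShift)
open Literature.MathematicalPhysics.QuantumLattice (blockMap)
open B8Ineq132 (covDerivFwd BondTouches)
open B8Eq140Level (SideTouches)
open B8Eq146AExpansion (iEta)
open B8Eq155JBound (Jcur)
open B8Eq138LandauZd (covLap)
open B8Eq138LandauZdRec (IsLandau138Z)
open B8Eq131CubesAdmissibleRec (cubeFamZ)
open B8CubeMemberZdRec (cubeLamSZ)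
open B8Ineq159FlatCubeMemberPrintedRec (cubeLamBPZ)
open B7SectEFLinearisationRec (linCovIterZ)
open Node00 (CubeB8DZ)

variable {d : ℕ}

/-! ## §1 The pure centred cube member, every truncation -/

/-- ★★ **[Balaban1985RegularSpaces] (1.59) ∕ (1.62) AT THE FLAT BACKGROUND `U₀ = 1` ON THE CENTRED CUBE FAMILY `{□_j}` OF (1.131), AVERAGING DATUM = THE RECORD's
LINEARISED `j`-FOLD AVERAGE `Q_j(1)`** ([4] Thm 3.3 at `U = 1` with Dirichlet exterior on `□₀`, for the operators (3.14)–(3.15) = linear parts of [3]'s averaging (89)–(92)):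
there are `B₀ > 0` and thresholds `ρ₀, M₀, N₀, R₀` such that for every `η > 0`, every cube datum `(a, M, ρ, k)`, `k ≥ 1`, on print's p. 98 big-block sub-lattice
(`M₀ ≤ L^{s+1}`, `L^{s+1} ∣ ρ`, `L^{s+1} ∣ M`, `R·L^{s+1} ≤ ρ`, `R₀ ≤ R`, `N₀ + 1 ≤ R·L^{s+1}`, `ρ₀ ≤ ρ`), every truncation `1 ≤ m ≤ k` and every ℂ-valued bond function `φ`
near `□₀` in the flat Landau gauge (1.38) for the RECORD blocking (`IsLandau138Z`, `Λ′`-tower `cubeLamSZ … m`): if `N ≥ 0` bounds (i) `(Lʲη)³|J(φ)|` on the bonds of `□_j`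
(`cubeFamZ`), (ii) the RECORD's linearised averages `|LʲηQ_j(1)(iηφ)(c)| = ‖linCovIterZ L 1 (iηφ) j c‖` ((3.15); = straight iterate + coarse gradient of the carried letter,
`B7Prop4FlatCarriedLetterRec.linCovIterZ_one_eq`) on every bond `c` of print's class `cubeLamBPZ … m j`, and (iii) `η|φ|` on the outer layer, then on every bond side-touching
`□_j`: `(Lʲη)|φ| ≤ B₀N`, `(Lʲη)²|D^η_{1,ν}φ_τ| ≤ B₀N`, `(Lʲη)³|Δ^η_1φ_τ| ≤ B₀N` — print's «|A|₍₋₁₎, |∇^η A|₍₋₂₎, |Δ^η A|₍₋₃₎ ≦ B₀(|J|₍₋₃₎ + |B₁|)» at `U₀ = 1`, pointwise form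
(1.62), centred tower.  The statement of dag-n05-e g38's PROVED straight-datum twin `B8Ineq159FlatCubeMemberPrintedRec.Ineq159FlatCubeMemberPrintedZ` with the single token
`linQIterZ L ↦ linCovIterZ L 1` in (ii).  NAMED here, NOT proved (see the module docstring).
[cite: Balaban1985RegularSpaces, (1.59) p.86, (1.62) p.87, (1.56) p.86, (1.31) p.82, (1.38) p.82, (1.131)–(1.132) p.99, p.98; Balaban1985BackgroundPropagators, (3.14)–(3.15) p.393, Thm 3.3 p.399, (3.47) p.398; Balaban1985Averaging, (89)–(92) p.31, (124) p.36; Balaban1987RG1, (0.3)–(0.4) pp.252–253] -/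
def Ineq159FlatCubeMemberCovPrintedZ (d L : ℕ) : Prop :=
  ∃ B₀ ρ₀ M₀ : ℝ, ∃ N₀ R₀ : ℕ, 0 < B₀ ∧
    ∀ (η : ℝ), 0 < η → ∀ (a : B7Prop1Explicit.Site d) (M ρ k s R : ℕ), 1 ≤ k →
      M₀ ≤ (L : ℝ) ^ (s + 1) → L ^ (s + 1) ∣ ρ → L ^ (s + 1) ∣ M → R * L ^ (s + 1) ≤ ρ → R₀ ≤ R →
      N₀ + 1 ≤ R * L ^ (s + 1) → ρ₀ ≤ (ρ : ℝ) →
      ∀ m, 1 ≤ m → m ≤ k → ∀ φ : B7Prop1Explicit.Site d → Fin d → ℂ,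
        IsLandau138Z L m η (cubeFamZ false L a M ρ k 0) (cubeLamSZ L a M ρ k m) (1 : B7Prop1Explicit.Site d → Fin d → ℂˣ) φ →
        (∀ (y : B7Prop1Explicit.Site d) (τ : Fin d), (∀ j, j ≤ m → ¬ SideTouches (cubeFamZ false L a M ρ k j) y τ) → φ y τ = 0) →
        ∀ N : ℝ, 0 ≤ N →
          (∀ j, j ≤ m → ∀ (y : B7Prop1Explicit.Site d) (τ : Fin d), BondTouches (cubeFamZ false L a M ρ k j) y τ →
              ((L : ℝ) ^ j * η) ^ 3 * ‖Jcur η (1 : B7Prop1Explicit.Site d → Fin d → ℂˣ) φ τ y‖ ≤ N) →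
          (∀ j, j ≤ m → ∀ c ∈ cubeLamBPZ L a M ρ k m j,
              ‖linCovIterZ L (1 : B7Prop1Explicit.Site d → Fin d → ℂˣ) (iEta η φ) j c.1 c.2‖ ≤ N) →
          (∀ (y : B7Prop1Explicit.Site d) (τ : Fin d), ¬ BondTouches (cubeFamZ false L a M ρ k 0) y τ → η * ‖φ y τ‖ ≤ N) →
          ∀ j, j ≤ m → ∀ (y : B7Prop1Explicit.Site d) (τ : Fin d), SideTouches (cubeFamZ false L a M ρ k j) y τ →
            ((L : ℝ) ^ j * η) * ‖φ y τ‖ ≤ B₀ * N ∧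
            (∀ ν : Fin d, ((L : ℝ) ^ j * η) ^ 2 *
                ‖covDerivFwd η (1 : B7Prop1Explicit.Site d → Fin d → ℂˣ) ν (fun z => φ z τ) y‖ ≤ B₀ * N) ∧
            ((L : ℝ) ^ j * η) ^ 3 * ‖covLap η (1 : B7Prop1Explicit.Site d → Fin d → ℂˣ) (fun z => φ z τ) y‖ ≤ B₀ * N

/-! ## §2 The dented centred cube member, top truncation -/

/-- ★★ **[Balaban1985RegularSpaces] (1.59) ∕ (1.62) AT THE FLAT BACKGROUND `U₀ = 1` ON THE DENTED CUBE TOWER `{Ω′_j}` OF [Balaban1985Variational] (148)–(150), TOP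
TRUNCATION, CENTRED TOWER, AVERAGING DATUM = THE RECORD's LINEARISED `j`-FOLD AVERAGE `Q_j(1)`** ([4] Thm 3.3 at `U = 1` with Dirichlet exterior on `□₀`, for
`Ω′₀ = □₀ ⊃ … ⊃ Ω′_{k−1} = □_{k−1} ⊃ Ω′_k = □_k ∩ Ω_k`, operators (3.14)–(3.15); [15] (152)): `B₀ > 0` and thresholds `ρ₀, M₀, N₀, R₀` such that for every `η > 0`, every
ambient family `{Ω_j}_{j ≤ K}`, every dented RECORD cube datum `c : CubeB8DZ d L K Ω` on print's p. 98 big-block sub-lattice (`M_h = Lˢ`; the seven side conditions verbatim)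
whose top member `Ω_k` is a union of cubes of side `L^{s+1}·Lᵏ` of the grid anchored at `□_k`'s fine lower corner `Lᵏ(c.a − c.ρ) − c_k·𝟙` ((1.4)₂ on the grid carrying `□_k`,
[15] p. 300), and every ℂ-valued `φ` in the flat Landau gauge (1.38) for the RECORD blocking on the dented tower (`IsLandau138Z`, `Ω′₀ = c.sq 0`, cells `c.lamS`): if `N ≥ 0`
bounds (i) `(Lʲη)³|J(φ)|` on the bonds of `Ω′_j`, (ii) the RECORD's linearised averages `‖linCovIterZ L 1 (iηφ) j b‖` on every bond `b` of print's class `c.lamBPZ j`, (iii)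
`η|φ|` on the outer layer, then on every bond side-touching `Ω′_j`: `(Lʲη)|φ| ≤ B₀N`, `(Lʲη)²|D^η_{1,ν}φ_τ| ≤ B₀N`, `(Lʲη)³|Δ^η_1φ_τ| ≤ B₀N`.  The statement of dag-n05-e g38's
PROVED straight-datum twin `B8Ineq159FlatDentedCubeMemberPrintedRec.Ineq159FlatDentedCubeMemberPrintedZ` with the single token `linQIterZ L ↦ linCovIterZ L 1` in (ii).
NAMED here, NOT proved (see the module docstring).
[cite: Balaban1985RegularSpaces, (1.59) p.86, (1.62) p.87, (1.56) p.86, (1.31) p.82, (1.38) p.82, (1.131)–(1.132) p.99, p.98, (1.4) p.77; Balaban1985Variational, (148)–(150) p.301, (152) p.301, p.300; Balaban1985BackgroundPropagators, (3.14)–(3.15) p.393, Thm 3.3 p.399, (3.47) p.398; Balaban1985Averaging, (89)–(92) p.31, (124) p.36; Balaban1987RG1, (0.3)–(0.4) pp.252–253] -/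
def Ineq159FlatDentedCubeMemberCovPrintedZ (d L : ℕ) : Prop :=
  ∃ B₀ ρ₀ M₀ : ℝ, ∃ N₀ R₀ : ℕ, 0 < B₀ ∧
    ∀ (η : ℝ), 0 < η → ∀ (K : ℕ) (Ω : ℕ → Set (B7Prop1Explicit.Site d)) (c : CubeB8DZ d L K Ω) (s R : ℕ),
      M₀ ≤ (L : ℝ) ^ (s + 1) → L ^ (s + 1) ∣ c.ρ → L ^ (s + 1) ∣ c.M → R * L ^ (s + 1) ≤ c.ρ → R₀ ≤ R →
      N₀ + 1 ≤ R * L ^ (s + 1) → ρ₀ ≤ (c.ρ : ℝ) →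
      (∀ x y : B7Prop1Explicit.Site d,
          blockMap (L ^ (s + 1) * L ^ c.k) (x - fun i => (L : ℤ) ^ c.k * (c.a i - c.ρ) - (ctrShift L c.k : ℤ)) =
            blockMap (L ^ (s + 1) * L ^ c.k) (y - fun i => (L : ℤ) ^ c.k * (c.a i - c.ρ) - (ctrShift L c.k : ℤ)) → x ∈ Ω c.k → y ∈ Ω c.k) →
      ∀ φ : B7Prop1Explicit.Site d → Fin d → ℂ,
        IsLandau138Z L c.k η (c.sq 0) c.lamS (1 : B7Prop1Explicit.Site d → Fin d → ℂˣ) φ →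
        (∀ (y : B7Prop1Explicit.Site d) (τ : Fin d), (∀ j, j ≤ c.k → ¬ SideTouches (c.sq j) y τ) → φ y τ = 0) →
        ∀ N : ℝ, 0 ≤ N →
          (∀ j, j ≤ c.k → ∀ (y : B7Prop1Explicit.Site d) (τ : Fin d), BondTouches (c.sq j) y τ →
              ((L : ℝ) ^ j * η) ^ 3 * ‖Jcur η (1 : B7Prop1Explicit.Site d → Fin d → ℂˣ) φ τ y‖ ≤ N) →
          (∀ j, j ≤ c.k → ∀ b ∈ c.lamBPZ j,
              ‖linCovIterZ L (1 : B7Prop1Explicit.Site d → Fin d → ℂˣ) (iEta η φ) j b.1 b.2‖ ≤ N) →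
          (∀ (y : B7Prop1Explicit.Site d) (τ : Fin d), ¬ BondTouches (c.sq 0) y τ → η * ‖φ y τ‖ ≤ N) →
          ∀ j, j ≤ c.k → ∀ (y : B7Prop1Explicit.Site d) (τ : Fin d), SideTouches (c.sq j) y τ →
            ((L : ℝ) ^ j * η) * ‖φ y τ‖ ≤ B₀ * N ∧
            (∀ ν : Fin d, ((L : ℝ) ^ j * η) ^ 2 *
                ‖covDerivFwd η (1 : B7Prop1Explicit.Site d → Fin d → ℂˣ) ν (fun z => φ z τ) y‖ ≤ B₀ * N) ∧
            ((L : ℝ) ^ j * η) ^ 3 * ‖covLap η (1 : B7Prop1Explicit.Site d → Fin d → ℂˣ) (fun z => φ z τ) y‖ ≤ B₀ * N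

end Literature.MathematicalPhysics.QuantumFieldTheory.Balaban1983to89.B8Ineq159FlatCovPrintedRec

end
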